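import Summits.AtomisticToContinuum.FouriersLaw.Theorems.EmbeddedDrudeMourreDrudeDissolutionStubPencilFrameworkDynamics
import Summits.AtomisticToContinuum.FouriersLaw.Theorems.EmbeddedDrudeMourreDrudeDissolutionStubPencilFrameworkLocalityB
import Summits.AtomisticToContinuum.FouriersLaw.Theorems.EmbeddedDrudeMourreDrudeDissolutionStubPencilFrameworkPolynomials
import Summits.AtomisticToContinuum.FouriersLaw.Theorems.EmbeddedDrudeMourreMourreDissolutionGibbsMixing
import Literature.MathematicalPhysics.KineticTheory.InfiniteChainClusteringTransfer
import Literature.MathematicalPhysics.KineticTheory.InfiniteChainTwoPointContinuity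
import Literature.MathematicalPhysics.KineticTheory.InfiniteChainSeveredGibbs
import Literature.MathematicalPhysics.KineticTheory.InfiniteChainGibbsInvariance
import Literature.MathematicalPhysics.KineticTheory.ZeroWavenumberDataOfClustering

/-!
# Stub F `stub_pencilFramework` of line `gram-pencil-harmonic-chaos`, part F-b: a regular Gibbs state
of `pinnedChain ω₂ lam β γ` (`lam, β ≥ 0`) with space–time `ℓ¹`-clustering of ALL local polynomials
along the Buttà–Marchioro flow
(crux `EmbeddedDrudeMourre.DrudeDissolution`, stmt-AtomisticToContinuum-12593; `--supports` file)

The `𝒫`-version of the tree's `MourreDissolution.stub_gibbsClustering` (which treats the two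
generators `j₀, h₀` for `lam, β > 0`): for `ω₂ > 0`, `lam, β ≥ 0`, every `T > 0` and the canonical
dynamics `D` (carrier `bmGood`, measurable flow, identity off `bmGood`) there is ONE measure `μ` —
the transfer-operator Markov state (`exists_gibbsState_mixing_pinnedChain`, sibling file
`…GibbsMixing`) — which is DLR at `T`, shift invariant, superstable, reflection invariant, and in
which, for all local polynomials `u, v ∈ 𝒫`, `x ↦ Cov_μ(u, (v ∘ τ_x) ∘ φ_t)` is summable for every
`t` and `t ↦ Σ_x Cov_μ(u, (u ∘ τ_x) ∘ φ_t)` is continuous at `0`.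

Assembly of proved inputs: invariance of `μ` under `D`
(`preservesMeasure_of_carrier_eq_bmGood`) and under the severed flows (LLL §4 (i)); input (L),
fixed-time `L²(μ)` locality of `u ∘ φ_t` for `u ∈ 𝒫` with summable rate (parts F-L1/F-L2, the box
version of `exists_summable_l2_locality`, fed with the polynomial Lipschitz moduli and moments of
part F-P); exponential `ρ`-mixing (M) of `μ`; the transfer (M) + (L) ⇒ clustering
(`summable_covariance_comp_chainShift_comp`, `continuousAt_tsum_covariance_comp_chainShift_comp`)
with the termwise two-point continuity `continuous_integral_mul_comp_flow` (Vitali).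
-/

noncomputable section

namespace Summit.AtomisticToContinuum.FouriersLaw.Theorems.DrudeDissolution.GramPencilHarmonicChaos

open MeasureTheory ProbabilityTheory Filter Set Function Topology
open scoped InnerProductSpace ENNReal
open Literature.MathematicalPhysics.KineticTheory
open Literature.MathematicalPhysics.KineticTheory.HeatConduction

/-- **Part F-b of stub F (registered helper): a regular Gibbs state with space–time clustering of
all local polynomials.** For `pinnedChain ω₂ lam β γ` (`ω₂ > 0`, `lam, β ≥ 0`; `γ` idle), every
`T > 0` and the canonical Buttà–Marchioro dynamics `D` (carrier `bmGood`, measurable flow,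
identity off `bmGood`): there is a DLR Gibbs state `μ` at `T` which is shift invariant, obeys the
superstability estimate, is invariant under `σ ↦ σ(-·)`, and in which, for all
`u, v ∈ 𝒫 = Algebra.adjoin ℝ {q_x, p_x}`, `x ↦ Cov_μ(u, (v ∘ τ_x) ∘ φ_t)` is summable for every
`t` and `t ↦ Σ_x Cov_μ(u, (u ∘ τ_x) ∘ φ_t)` is continuous at `0`.
[cite: ButtaMarchioro2016, §2 Thm 2.1–2.2 and §3] -/
theorem pencilFramework_clustering : ∀ (ω₂ lam β γ : ℝ), 0 < ω₂ → 0 ≤ lam → 0 ≤ β → ∀ T : ℝ, 0 < T → ∀ D : Literature.MathematicalPhysics.KineticTheory.HeatConduction.InfiniteChainDynamics (Literature.MathematicalPhysics.KineticTheory.HeatConduction.pinnedChain ω₂ lam β γ), D.carrier = (Literature.MathematicalPhysics.KineticTheory.HeatConduction.pinnedChain ω₂ lam β γ).bmGood → (∀ t : ℝ, Measurable (D.flow t)) → (∀ (t : ℝ) (σ : Literature.MathematicalPhysics.KineticTheory.HeatConduction.ChainConfig), σ ∉ (Literature.MathematicalPhysics.KineticTheory.HeatConduction.pinnedChain ω₂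 lam β γ).bmGood → D.flow t σ = σ) → ∃ μ : MeasureTheory.Measure (ℤ → ℝ × ℝ), (Literature.MathematicalPhysics.KineticTheory.HeatConduction.pinnedChain ω₂ lam β γ).IsChainGibbsMeasure T μ ∧ Literature.MathematicalPhysics.KineticTheory.HeatConduction.IsShiftInvariant μ ∧ (Literature.MathematicalPhysics.KineticTheory.HeatConduction.pinnedChain ω₂ lam β γ).HasSuperstabilityEstimate μ ∧ μ.map (fun (σ : ℤ → ℝ × ℝ) (x : ℤ) => σ (-x)) = μ ∧ (∀ u ∈ Algebra.adjoin ℝ (Set.range fun xc : ℤ × Bool => fun σ : Literature.MathematicalPhysics.KineticTheory.HeatConduction.ChainConfig => if xc.2 then (σ xc.1).2 else (σ xc.1).1), ∀ v ∈ Algebra.adjoin ℝ (Set.range fun xc : ℤ × Bool => fun σ : Literature.MathematicalPhysics.KineticTheory.HeatConduction.ChainConfig => if xc.2 then (σ xc.1).2 else (σ xc.1).1), ∀ t : ℝ, Summable fun x : ℤ => ProbabilityTheory.covariance u ((v ∘ Literature.MathematicalPhysics.KineticTheory.HeatConduction.chainShift x) ∘ D.flow t) μ) ∧ (∀ u ∈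 Algebra.adjoin ℝ (Set.range fun xc : ℤ × Bool => fun σ : Literature.MathematicalPhysics.KineticTheory.HeatConduction.ChainConfig => if xc.2 then (σ xc.1).2 else (σ xc.1).1), ContinuousAt (fun t : ℝ => ∑' x : ℤ, ProbabilityTheory.covariance u ((u ∘ Literature.MathematicalPhysics.KineticTheory.HeatConduction.chainShift x) ∘ D.flow t) μ) 0) := by
  -- adapted from `MourreDissolution.stub_gibbsClustering` (generators `j₀, h₀` ↦ all of `𝒫`)
  intro ω₂ lam β γ hω hl hβ T hT D hcar hmeas hid
  obtain ⟨s₁, hs₁, hU1⟩ := exists_isEvenPolyOfDegree_U_pinnedChain β γ hω hl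
  obtain ⟨s₂, hs₂, hV1⟩ := exists_isEvenPolyOfDegree_V_pinnedChain ω₂ lam γ hβ
  have hU0 : ∀ r, 0 ≤ (pinnedChain ω₂ lam β γ).U r := hU1.choose_spec.2.2
  have hV0 : ∀ r, 0 ≤ (pinnedChain ω₂ lam β γ).V r := hV1.choose_spec.2.2
  have hU : ContDiff ℝ 2 (pinnedChain ω₂ lam β γ).U := hU1.contDiff_two
  have hV : ContDiff ℝ 2 (pinnedChain ω₂ lam β γ).V := hV1.contDiff_two
  have hB1 : (pinnedChain ω₂ lam β γ).CondB1 := OscillatorChain.condB1_pinnedChain hω.le hl hβ γ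
  -- the state: DLR, shift invariant, superstable, reflection invariant, exponentially mixing (M)
  obtain ⟨μ, hG, hS, hss, hrefl, C, m, hm, hmix⟩ :=
    MourreDissolution.exists_gibbsState_mixing_pinnedChain ω₂ lam β γ hω hl hβ T hT
  haveI : IsProbabilityMeasure μ := hss.1
  -- `μ` is invariant under the flow of `D` and under the severed box flows
  have hD : D.PreservesMeasure μ :=
    OscillatorChain.preservesMeasure_of_carrier_eq_bmGood hs₁ hs₂ hU1 hV1 D hcar hmeas hG hss
  have hsev : ∀ (n : ℕ) (t : ℝ), MeasurePreserving
      (OscillatorChain.severedFlow hB1 (Finset.Icc ((0 : ℤ) - n) ((0 : ℤ) + n)) t) μ μ := fun n t =>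
    OscillatorChain.measurePreserving_severedFlow_of_isChainGibbsMeasure hU hV hB1 _ hG t
  have hτ : ∀ x : ℤ, MeasurePreserving (chainShift x) μ μ := hS.measurePreserving_chainShift
  -- the flow commutes with the translations everywhere
  have hφ : ∀ (t : ℝ) (x : ℤ), D.flow t ∘ chainShift x = chainShift x ∘ D.flow t := fun t x =>
    funext fun σ => D.flow_chainShift_of_eq_id hcar hid hU0 hV0 t x σ
  -- the mixing constant may be taken non-negative
  have hmix' : ∀ (a : ℤ) (n : ℕ) (f g : ChainConfig → ℝ),
      DependsOn f {i : ℤ | i ≤ a} → DependsOn g {i : ℤ | a + n ≤ i} → Measurable f → Measurable g →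
      MemLp f 2 μ → MemLp g 2 μ →
      |∫ σ, f σ * g σ ∂μ - (∫ σ, f σ ∂μ) * ∫ σ, g σ ∂μ| ≤
        max C 0 * Real.exp (-(m * n)) * (∫ σ, f σ ^ 2 ∂μ) ^ (1 / 2 : ℝ) *
          (∫ σ, g σ ^ 2 ∂μ) ^ (1 / 2 : ℝ) := by
    intro a n f g h1 h2 h3 h4 h5 h6
    refine (hmix a n f g h1 h2 h3 h4 h5 h6).trans ?_
    have hA : 0 ≤ (∫ σ, f σ ^ 2 ∂μ) ^ (1 / 2 : ℝ) :=
      Real.rpow_nonneg (integral_nonneg fun _ => sq_nonneg _) _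
    have hB : 0 ≤ (∫ σ, g σ ^ 2 ∂μ) ^ (1 / 2 : ℝ) :=
      Real.rpow_nonneg (integral_nonneg fun _ => sq_nonneg _) _
    have hE : 0 ≤ Real.exp (-(m * n)) := Real.exp_nonneg _
    have : C * Real.exp (-(m * n)) ≤ max C 0 * Real.exp (-(m * n)) :=
      mul_le_mul_of_nonneg_right (le_max_left _ _) hE
    exact mul_le_mul_of_nonneg_right (mul_le_mul_of_nonneg_right this hA) hB
  -- every local polynomial: measurable, square integrable, box-local, `L²`-local along the flow (L)
  have hpkg : ∀ u ∈ Algebra.adjoin ℝ (Set.range fun xc : ℤ × Bool => fun σ : ChainConfig =>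
      if xc.2 then (σ xc.1).2 else (σ xc.1).1),
      Measurable u ∧ MemLp u 2 μ ∧ Integrable (fun σ => u σ ^ 4) μ ∧ ∃ k : ℕ,
        DependsOn u (Icc (-(k : ℤ)) k) ∧
        ∀ τ : ℝ, 0 ≤ τ → ∃ ε : ℕ → ℝ, (∀ n, 0 ≤ ε n) ∧ Summable ε ∧ ∀ t : ℝ, |t| ≤ τ → ∀ n : ℕ,
          ∃ g : ChainConfig → ℝ, DependsOn g (Icc (-((n + (k + 1) : ℕ) : ℤ)) ((n + (k + 1) : ℕ))) ∧
            Measurable g ∧ MemLp g 2 μ ∧ Real.sqrt (∫ σ, (u (D.flow t σ) - g σ) ^ 2 ∂μ) ≤ ε n := by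
    intro u hu
    obtain ⟨hum, hu2, hu4⟩ := moments_of_mem_polyObs γ hω hl hβ hT hG hS hu
    obtain ⟨k, Cu, du, hCu, hdep, hLip⟩ := pencilFramework_polynomials u hu
    refine ⟨hum, hu2, hu4, k, hdep, fun τ hτ => ?_⟩
    obtain ⟨ε, hε0, hε, hmain⟩ := pencilFramework_localityB (pinnedChain ω₂ lam β γ) s₁ s₂ D hs₁ hs₂
      hU1 hV1 hcar hB1 μ hss hD hsev k u hum hdep hu2 hu4 Cu du hCu
      (fun σ σ' R δ hR hδ0 hδ1 h => (hLip σ σ' R δ hR hδ0 hδ1 h).1) τ hτ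
    refine ⟨ε, hε0, hε, fun t ht n => ?_⟩
    obtain ⟨h1, h2, h3, h4⟩ := hmain t ht n
    refine ⟨_, h1.mono fun i hi => ?_, h2, h3, h4⟩
    simp only [mem_Icc, Nat.cast_add, Nat.cast_one] at hi ⊢
    constructor <;> omega
  refine ⟨μ, hG, hS, hss, hrefl, ?_, ?_⟩
  · -- summable space–time clustering of the pairs `u`, `(v ∘ τ_x) ∘ φ_t`
    intro u hu v hv t
    obtain ⟨hum, hu2, -, ku, hdepu, -⟩ := hpkg u hu
    obtain ⟨hvm, hv2, -, kv, -, hlocv⟩ := hpkg v hv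
    obtain ⟨ε, hε0, hε, happrox⟩ := hlocv |t| (abs_nonneg t)
    refine summable_covariance_comp_chainShift_comp hmix' hm hτ hdepu hum hu2 (kv + 1) (hφ t)
      (hvm.comp (hmeas t)) (hv2.comp_measurePreserving (hD.2 t)) hε0 hε fun n => ?_
    obtain ⟨g, hgd, hgm, hg2, hge⟩ := happrox t le_rfl n
    exact ⟨g, hgd, hgm, hg2, hge⟩
  · -- continuity at `0` of the summed autocovariances
    intro u hu
    obtain ⟨hum, hu2, hu4, k, hdep, hloc⟩ := hpkg u hu
    obtain ⟨ε, hε0, hε, happrox⟩ := hloc 1 zero_le_one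
    refine continuousAt_tsum_covariance_comp_chainShift_comp hmix' hm hτ hdep hum hu2 (k + 1)
      (Real.sqrt (∫ σ, u σ ^ 2 ∂μ)) hε0 hε hφ ?_ fun x => ?_
    · have h1 : ∀ᶠ t in 𝓝 (0 : ℝ), |t| ≤ 1 := by
        filter_upwards [Icc_mem_nhds (show (-1 : ℝ) < 0 by norm_num) (show (0 : ℝ) < 1 by norm_num)]
          with t ht
        exact abs_le.2 ⟨ht.1, ht.2⟩
      filter_upwards [h1] with t ht
      refine ⟨hum.comp (hmeas t), hu2.comp_measurePreserving (hD.2 t),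
        Real.sqrt_le_sqrt (integral_sq_comp_eq' (hD.2 t) hum).le, fun n => ?_⟩
      obtain ⟨g, hgd, hgm, hg2, hge⟩ := happrox t ht n
      exact ⟨g, hgd, hgm, hg2, hge⟩
    · -- termwise continuity (Vitali)
      have hux : u ∘ chainShift x ∈ Algebra.adjoin ℝ (Set.range fun xc : ℤ × Bool =>
          fun σ : ChainConfig => if xc.2 then (σ xc.1).2 else (σ xc.1).1) :=
        comp_chainShift_mem_polyObs x hu
      obtain ⟨huxm, hux2, hux4⟩ := moments_of_mem_polyObs γ hω hl hβ hT hG hS hux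
      have hc : Continuous fun t : ℝ => ∫ σ, u σ * (u ∘ chainShift x) (D.flow t σ) ∂μ :=
        D.continuous_integral_mul_comp_flow hD hum huxm hu4 hux4 fun σ hσ =>
          continuous_comp_flow_of_mem_polyObs D hux hσ
      have hterm : (fun t : ℝ => cov[u, (u ∘ chainShift x) ∘ D.flow t; μ]) = fun t : ℝ =>
          (∫ σ, u σ * (u ∘ chainShift x) (D.flow t σ) ∂μ) -
            (∫ σ, u σ ∂μ) * ∫ σ, (u ∘ chainShift x) σ ∂μ := by
        funext t
        rw [covariance_eq_sub hu2 (hux2.comp_measurePreserving (hD.2 t))]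
        have hmean : ∫ σ, ((u ∘ chainShift x) ∘ D.flow t) σ ∂μ = ∫ σ, (u ∘ chainShift x) σ ∂μ := by
          have hm' : AEStronglyMeasurable (u ∘ chainShift x) (μ.map (D.flow t)) := by
            rw [(hD.2 t).map_eq]
            exact huxm.aestronglyMeasurable
          have h := integral_map (hD.2 t).measurable.aemeasurable hm'
          rw [(hD.2 t).map_eq] at h
          exact h.symm
        rw [hmean]
        rfl
      rw [hterm]
      exact (hc.sub continuous_const).continuousAt

end Summit.AtomisticToContinuum.FouriersLaw.Theorems.DrudeDissolution.GramPencilHarmonicChaos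

end
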